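import Mathlib.Analysis.SpecialFunctions.Exponential
import Mathlib.Analysis.SpecialFunctions.Integrals.Basic
import Mathlib.Analysis.SpecificLimits.Normed
import Mathlib.Analysis.Complex.Basic
import Mathlib.MeasureTheory.Integral.DominatedConvergence
import Mathlib.MeasureTheory.Integral.Pi
import Mathlib.MeasureTheory.Measure.Lebesgue.Basic
import HarnessLib

/-!
# Exponentials of trigonometric polynomials with non-negative coefficients have non-negative
# Fourier coefficients (angle cube `[0,2π]^ι`)

Let `ι` be a finite index set ("sites"), `θ ∈ [0,2π]^ι` angles, and for an integer frequency
vector `m : ι → ℤ` write `e_m(θ) = exp(i Σ_x m_x θ_x)` for the corresponding character of the torus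
`(ℝ/2πℤ)^ι`.  For a finite family of frequencies `m_j` with NON-NEGATIVE real coefficients
`β_j ≥ 0`, the weight `w(θ) = exp(Σ_j β_j e_{m_j}(θ))` is in general genuinely complex, but all its
Fourier coefficients are non-negative reals:

* `integral_cexp_phase_mul_cexp_sum` — for every frequency `a`,
  `∫_{[0,2π]^ι} e_a(θ) · exp(Σ_j β_j e_{m_j}(θ)) dθ = R` with `R ∈ ℝ`, `R ≥ 0`, and `R ≥ (2π)^{|ι|}`
  when `a = 0`;
* `integral_cexp_const_add_sum` — consequently
  `∫ exp(β₀ + Σ_j β_j e_{m_j}) dθ = e^{β₀} · R`, `R ≥ (2π)^{|ι|}`, for any complex constant `β₀`: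
  such a "partition function" is `e^{β₀}` times a positive real, in particular it never vanishes
  (`integral_cexp_const_add_sum_ne_zero`, `integral_cexp_const_add_sum_pos`).

This is the torus case of the folklore fact that the exponential of a positive-definite function on a
compact abelian group is positive-definite (Schur's product theorem / Bochner), written for Lebesgue
measure on the cube so that it applies verbatim to lattice rotator models whose (complex) Gibbs factor
has a character expansion with non-negative coefficients ("positive-definite", or generalised
ferromagnetic, interactions in the sense of J. Ginibre, Comm. Math. Phys. 16 (1970) 310–328): for them
the complex partition function is a positive real for every volume and every inverse temperature, with
no symmetry or reflection-positivity hypothesis.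

Proof: induction on the family.  Adding one mode `β e_μ` multiplies the weight by
`exp(β e_μ) = Σ_k (β^k/k!) e_{kμ}` (uniformly convergent), so by dominated convergence the coefficient at
`a` of the new weight is `Σ_k (β^k/k!) · (coefficient at a + kμ of the old weight)`, a convergent series
of non-negative reals whose `k = 0` term is the old coefficient; the base case is the orthogonality of
characters `∫ e_a = (2π)^{|ι|} 𝟙{a = 0}` (`integral_angleCube_cexp_phase`).  Everything is stated with
the explicit expressions (no definition is introduced), in the syntactic form
`Complex.exp (Complex.I * ((∑ x, (m x : ℝ) * θ x : ℝ) : ℂ))` used by the lattice-model files of the tree.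
-/

noncomputable section

open MeasureTheory Finset
open scoped BigOperators

namespace Literature.Analysis.Fourier

/-- `∫_0^{2π} e^{i n t} dt = 2π · 𝟙{n = 0}` for an integer `n` (interval-integral form). [folklore] -/
theorem intervalIntegral_two_pi_cexp_int_mul (n : ℤ) :
    ∫ t in (0:ℝ)..(2 * Real.pi), Complex.exp (Complex.I * (((n : ℝ) * t : ℝ) : ℂ)) =
      if n = 0 then ((2 * Real.pi : ℝ) : ℂ) else 0 := by
  split_ifs with hn
  · subst hn
    simp
  · have hc : (Complex.I * (n : ℂ)) ≠ 0 := by simp [Complex.I_ne_zero, hn]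
    have key : ∀ t : ℝ, Complex.exp (Complex.I * (((n : ℝ) * t : ℝ) : ℂ)) =
        Complex.exp ((Complex.I * (n : ℂ)) * t) := by
      intro t; congr 1; push_cast; ring
    simp_rw [key]
    rw [integral_exp_mul_complex hc]
    have h2 : Complex.exp (Complex.I * (n : ℂ) * (2 * (Real.pi : ℂ))) = 1 := by
      have : Complex.I * (n : ℂ) * (2 * (Real.pi : ℂ)) = (n : ℂ) * (2 * Real.pi * Complex.I) := by ring
      rw [this]
      exact Complex.exp_int_mul_two_pi_mul_I n
    push_cast
    simp [h2]

variable {ι : Type*} [Fintype ι]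

/-- The cube measure `dθ` on `[0,2π]^ι` is the product of `|ι|` copies of Lebesgue measure on `[0,2π]`.
[folklore] -/
theorem restrict_angleCube_eq_pi :
    (volume : Measure (ι → ℝ)).restrict (Set.pi Set.univ (fun _ => Set.Icc (0:ℝ) (2 * Real.pi))) =
      Measure.pi (fun _ : ι => (volume : Measure ℝ).restrict (Set.Icc (0:ℝ) (2 * Real.pi))) := by
  rw [volume_pi, Measure.restrict_pi_pi]

/-- The cube `[0,2π]^ι` has finite Lebesgue measure. [folklore] -/
theorem volume_angleCube_lt_top :
    volume (Set.pi Set.univ (fun _ : ι => Set.Icc (0:ℝ) (2 * Real.pi))) < ⊤ := by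
  rw [volume_pi, Measure.pi_pi]
  exact ENNReal.prod_lt_top (fun _ _ => by rw [Real.volume_Icc]; exact ENNReal.ofReal_lt_top)

/-- The cube measure `dθ` on `[0,2π]^ι` is finite (stated as a theorem, to be introduced locally with
`haveI`; used for `integrable_const` and dominated convergence). [folklore] -/
theorem isFiniteMeasure_restrict_angleCube :
    IsFiniteMeasure ((volume : Measure (ι → ℝ)).restrict
      (Set.pi Set.univ (fun _ : ι => Set.Icc (0:ℝ) (2 * Real.pi)))) :=
  isFiniteMeasure_restrict.2 volume_angleCube_lt_top.ne

/-- **Orthogonality of characters on the angle cube**: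
`∫_{[0,2π]^ι} e^{i m·θ} dθ = (2π)^{|ι|} · 𝟙{m = 0}` for `m ∈ ℤ^ι`. [folklore] -/
theorem integral_angleCube_cexp_phase (m : ι → ℤ) :
    ∫ θ, Complex.exp (Complex.I * ((∑ x, (m x : ℝ) * θ x : ℝ) : ℂ))
        ∂(volume.restrict (Set.pi Set.univ (fun _ : ι => Set.Icc (0:ℝ) (2 * Real.pi)))) =
      if m = 0 then ((2 * Real.pi : ℝ) : ℂ) ^ Fintype.card ι else 0 := by
  rw [restrict_angleCube_eq_pi]
  set f : ι → ℝ → ℂ := fun x t => Complex.exp (Complex.I * ((((m x : ℝ) * t : ℝ)) : ℂ)) with hf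
  have key : ∀ θ : ι → ℝ,
      Complex.exp (Complex.I * ((∑ x, (m x : ℝ) * θ x : ℝ) : ℂ)) = ∏ x, f x (θ x) := by
    intro θ
    simp only [hf, ← Complex.exp_sum]
    congr 1
    push_cast
    rw [Finset.mul_sum]
  simp_rw [key]
  rw [integral_fintype_prod_eq_prod (𝕜 := ℂ) f]
  have hj : ∀ x, ∫ t, f x t ∂((volume : Measure ℝ).restrict (Set.Icc (0:ℝ) (2 * Real.pi))) =
      if m x = 0 then ((2 * Real.pi : ℝ) : ℂ) else 0 := fun x => by
    rw [integral_Icc_eq_integral_Ioc, ← intervalIntegral.integral_of_le (by positivity : (0:ℝ) ≤ 2 * Real.pi)]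
    exact intervalIntegral_two_pi_cexp_int_mul (m x)
  simp_rw [hj]
  split_ifs with hm
  · subst hm
    simp
  · obtain ⟨x, hx⟩ : ∃ x, m x ≠ 0 := by
      by_contra h
      push Not at h
      exact hm (funext h)
    exact Finset.prod_eq_zero (Finset.mem_univ x) (if_neg hx)

/-- Characters are unimodular: `‖e^{i m·θ}‖ = 1`. [folklore] -/
theorem norm_cexp_phase (m : ι → ℤ) (θ : ι → ℝ) :
    ‖Complex.exp (Complex.I * ((∑ x, (m x : ℝ) * θ x : ℝ) : ℂ))‖ = 1 := by
  rw [mul_comm, Complex.norm_exp_ofReal_mul_I]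

/-- Product of characters: `e_a · e_m = e_{a+m}`. [folklore] -/
theorem cexp_phase_mul_cexp_phase (a m : ι → ℤ) (θ : ι → ℝ) :
    Complex.exp (Complex.I * ((∑ x, (a x : ℝ) * θ x : ℝ) : ℂ)) *
        Complex.exp (Complex.I * ((∑ x, (m x : ℝ) * θ x : ℝ) : ℂ)) =
      Complex.exp (Complex.I * ((∑ x, ((a + m) x : ℝ) * θ x : ℝ) : ℂ)) := by
  rw [← Complex.exp_add]
  congr 1
  simp only [Pi.add_apply, Int.cast_add, add_mul, Finset.sum_add_distrib]
  push_cast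
  ring

/-- Powers of characters: `(e_m)^k = e_{k•m}`. [folklore] -/
theorem cexp_phase_pow (m : ι → ℤ) (θ : ι → ℝ) (k : ℕ) :
    Complex.exp (Complex.I * ((∑ x, (m x : ℝ) * θ x : ℝ) : ℂ)) ^ k =
      Complex.exp (Complex.I * ((∑ x, ((k • m) x : ℝ) * θ x : ℝ) : ℂ)) := by
  rw [← Complex.exp_nat_mul]
  congr 1
  have h : ∀ x, (((k • m) x : ℤ) : ℝ) = (k : ℝ) * (m x : ℝ) := fun x => by simp
  simp_rw [h]
  push_cast
  simp only [Finset.mul_sum]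
  refine Finset.sum_congr rfl fun x _ => ?_
  ring

/-- The weight `exp(Σ_{j∈s} β_j e_{m_j}(θ))` is continuous in `θ`. [folklore] -/
theorem continuous_cexp_sum_phase {J : Type*} (s : Finset J) (β : J → ℝ) (m : J → ι → ℤ) :
    Continuous fun θ : ι → ℝ =>
      Complex.exp (∑ j ∈ s, (β j : ℂ) * Complex.exp (Complex.I * ((∑ x, (m j x : ℝ) * θ x : ℝ) : ℂ))) := by
  fun_prop

/-- Norm bound for the weight: `‖exp(Σ_{j∈s} β_j e_{m_j}(θ))‖ ≤ exp(Σ_{j∈s} |β_j|)`. [folklore] -/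
theorem norm_cexp_sum_phase_le {J : Type*} (s : Finset J) (β : J → ℝ) (m : J → ι → ℤ) (θ : ι → ℝ) :
    ‖Complex.exp (∑ j ∈ s, (β j : ℂ) * Complex.exp (Complex.I * ((∑ x, (m j x : ℝ) * θ x : ℝ) : ℂ)))‖ ≤
      Real.exp (∑ j ∈ s, |β j|) := by
  rw [Complex.norm_exp]
  refine Real.exp_le_exp.2 ((Complex.re_le_norm _).trans ((norm_sum_le _ _).trans ?_))
  refine Finset.sum_le_sum fun j _ => ?_
  rw [norm_mul, norm_cexp_phase, mul_one, Complex.norm_real, Real.norm_eq_abs]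

/-- **Fourier coefficients of `exp` of a non-negative trigonometric polynomial are non-negative reals.**
For a finite family of integer frequency vectors `m_j : ι → ℤ` with coefficients `β_j ≥ 0` (`j ∈ s`) and
any frequency `a`, the cube integral `∫_{[0,2π]^ι} e^{i a·θ} exp(Σ_{j∈s} β_j e^{i m_j·θ}) dθ` is a real
number `R ≥ 0`, and `R ≥ (2π)^{|ι|}` when `a = 0` (the constant term of the exponential series already
contributes `(2π)^{|ι|}`).  No symmetry of the family is assumed: the weight is genuinely complex in
general. [folklore] -/
theorem integral_cexp_phase_mul_cexp_sum {J : Type*} (s : Finset J) (β : J → ℝ)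
    (hβ : ∀ j ∈ s, 0 ≤ β j) (m : J → ι → ℤ) (a : ι → ℤ) :
    ∃ R : ℝ, 0 ≤ R ∧ (a = 0 → (2 * Real.pi) ^ Fintype.card ι ≤ R) ∧
      ∫ θ, Complex.exp (Complex.I * ((∑ x, (a x : ℝ) * θ x : ℝ) : ℂ)) *
          Complex.exp (∑ j ∈ s, (β j : ℂ) * Complex.exp (Complex.I * ((∑ x, (m j x : ℝ) * θ x : ℝ) : ℂ)))
        ∂(volume.restrict (Set.pi Set.univ (fun _ : ι => Set.Icc (0:ℝ) (2 * Real.pi)))) = (R : ℂ) := by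
  classical
  -- the cube measure, abbreviated
  set μc : Measure (ι → ℝ) :=
    volume.restrict (Set.pi Set.univ (fun _ : ι => Set.Icc (0:ℝ) (2 * Real.pi))) with hμc
  haveI : IsFiniteMeasure μc := by rw [hμc]; exact isFiniteMeasure_restrict_angleCube
  -- characters, abbreviated
  set e : (ι → ℤ) → (ι → ℝ) → ℂ := fun n θ =>
    Complex.exp (Complex.I * ((∑ x, (n x : ℝ) * θ x : ℝ) : ℂ)) with he'
  have he : ∀ n θ, e n θ = Complex.exp (Complex.I * ((∑ x, (n x : ℝ) * θ x : ℝ) : ℂ)) := fun _ _ => rfl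
  have hec : ∀ n, Continuous (e n) := fun n => by rw [he']; fun_prop
  induction s using Finset.induction_on generalizing a with
  | empty =>
    refine ⟨if a = 0 then (2 * Real.pi) ^ Fintype.card ι else 0, ?_, ?_, ?_⟩
    · split_ifs <;> positivity
    · intro ha; simp [ha]
    · simp only [Finset.sum_empty, Complex.exp_zero, mul_one]
      rw [hμc, integral_angleCube_cexp_phase]
      split_ifs <;> simp
  | @insert j₀ s hj₀ ih =>
    -- notation for the pieces
    set b : ℝ := β j₀ with hb
    have hb0 : 0 ≤ b := hβ j₀ (Finset.mem_insert_self _ _)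
    have hβs : ∀ j ∈ s, 0 ≤ β j := fun j hj => hβ j (Finset.mem_insert_of_mem hj)
    set μ₀ : ι → ℤ := m j₀ with hμ₀
    -- the old weight `G`
    set G : (ι → ℝ) → ℂ := fun θ =>
      Complex.exp (∑ j ∈ s, (β j : ℂ) * Complex.exp (Complex.I * ((∑ x, (m j x : ℝ) * θ x : ℝ) : ℂ)))
      with hG
    have hGc : Continuous G := by rw [hG]; exact continuous_cexp_sum_phase s β m
    have hGn : ∀ θ, ‖G θ‖ ≤ Real.exp (∑ j ∈ s, |β j|) := fun θ => norm_cexp_sum_phase_le s β m θ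
    -- the old coefficients, from the induction hypothesis
    choose R hR using fun k : ℕ => ih hβs (a + k • μ₀)
    -- the terms of the series and their integrals
    set F : ℕ → (ι → ℝ) → ℂ := fun k θ =>
      ((b ^ k / (k.factorial : ℝ) : ℝ) : ℂ) * (e (a + k • μ₀) θ * G θ) with hF
    have hF_int : ∀ k, ∫ θ, F k θ ∂μc = (((b ^ k / (k.factorial : ℝ)) * R k : ℝ) : ℂ) := by
      intro k
      have hk := (hR k).2.2
      simp only [hF]
      rw [integral_const_mul]
      erw [hk]
      push_cast
      ring
    -- the new integrand is the sum of the series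
    have h_lim : ∀ θ, HasSum (fun k => F k θ)
        (e a θ * Complex.exp ((b : ℂ) * e μ₀ θ) * G θ) := by
      intro θ
      have hexp : HasSum (fun k : ℕ => ((k.factorial : ℂ)⁻¹) • ((b : ℂ) * e μ₀ θ) ^ k)
          (Complex.exp ((b : ℂ) * e μ₀ θ)) := by
        have h := NormedSpace.exp_series_hasSum_exp' (𝕂 := ℂ) ((b : ℂ) * e μ₀ θ)
        rwa [← Complex.exp_eq_exp_ℂ] at h
      have h2 := (hexp.mul_left (e a θ)).mul_right (G θ)
      refine h2.congr_fun fun k => ?_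
      -- `F k θ = e_a · (k!⁻¹ • (b e_μ₀)^k) · G`
      have hpow : ((b : ℂ) * e μ₀ θ) ^ k = (b : ℂ) ^ k * e (k • μ₀) θ := by
        rw [mul_pow]
        congr 1
        exact cexp_phase_pow μ₀ θ k
      have hmul : e a θ * e (k • μ₀) θ = e (a + k • μ₀) θ := cexp_phase_mul_cexp_phase a (k • μ₀) θ
      simp only [hF]
      rw [hpow, smul_eq_mul, ← hmul]
      push_cast
      ring
    -- dominated convergence for series
    have hsum : HasSum (fun k => ∫ θ, F k θ ∂μc)
        (∫ θ, e a θ * Complex.exp ((b : ℂ) * e μ₀ θ) * G θ ∂μc) := by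
      refine hasSum_integral_of_dominated_convergence
        (fun k _ => b ^ k / (k.factorial : ℝ) * Real.exp (∑ j ∈ s, |β j|))
        (fun k => ?_) (fun k => ?_) ?_ ?_ ?_
      · have hc : Continuous (F k) := by
          rw [hF]; exact continuous_const.mul ((hec _).mul hGc)
        exact hc.aestronglyMeasurable
      · refine ae_of_all _ fun θ => ?_
        simp only [hF, norm_mul, Complex.norm_real, Real.norm_eq_abs]
        rw [abs_of_nonneg (by positivity), he, norm_cexp_phase, one_mul]
        exact mul_le_mul_of_nonneg_left (hGn θ) (by positivity)
      · exact ae_of_all _ fun θ => (Real.summable_pow_div_factorial b).mul_right _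
      · exact integrable_const _
      · exact ae_of_all _ fun θ => h_lim θ
    -- identify the new integral with the integral of the sum
    have hnew : ∫ θ, Complex.exp (Complex.I * ((∑ x, (a x : ℝ) * θ x : ℝ) : ℂ)) *
          Complex.exp (∑ j ∈ insert j₀ s,
            (β j : ℂ) * Complex.exp (Complex.I * ((∑ x, (m j x : ℝ) * θ x : ℝ) : ℂ))) ∂μc =
        ∫ θ, e a θ * Complex.exp ((b : ℂ) * e μ₀ θ) * G θ ∂μc := by
      refine integral_congr_ae (ae_of_all _ fun θ => ?_)
      simp only [Finset.sum_insert hj₀, Complex.exp_add, hG, he, hb, hμ₀]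
      ring
    -- the series of integrals is a real non-negative series
    have hsumR : HasSum (fun k => (((b ^ k / (k.factorial : ℝ)) * R k : ℝ) : ℂ))
        (∫ θ, e a θ * Complex.exp ((b : ℂ) * e μ₀ θ) * G θ ∂μc) :=
      hsum.congr_fun fun k => (hF_int k).symm
    set Z : ℂ := ∫ θ, e a θ * Complex.exp ((b : ℂ) * e μ₀ θ) * G θ ∂μc with hZ
    have hre : HasSum (fun k => (b ^ k / (k.factorial : ℝ)) * R k) Z.re := by
      have h := Complex.hasSum_re hsumR
      simp only [Complex.ofReal_re] at h
      exact h
    have him : Z.im = 0 := by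
      have h := Complex.hasSum_im hsumR
      simp only [Complex.ofReal_im] at h
      exact h.unique hasSum_zero
    have hterm : ∀ k, 0 ≤ (b ^ k / (k.factorial : ℝ)) * R k := fun k =>
      mul_nonneg (by positivity) (hR k).1
    refine ⟨Z.re, hre.nonneg hterm, fun ha => ?_, ?_⟩
    · have h0 : (b ^ 0 / ((0 : ℕ).factorial : ℝ)) * R 0 ≤ Z.re :=
        le_hasSum hre 0 (fun k _ => hterm k)
      have hR0 : (2 * Real.pi) ^ Fintype.card ι ≤ R 0 := (hR 0).2.1 (by simp [ha])
      simp only [pow_zero, Nat.factorial_zero, Nat.cast_one, div_one, one_mul] at h0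
      exact hR0.trans h0
    · rw [hnew]
      exact Complex.ext (by simp) (by simp [him])

/-- **Positivity of "positive-definite" partition functions on the angle cube.**  For a complex constant
`β₀`, non-negative coefficients `β_j ≥ 0` and integer frequency vectors `m_j`,
`∫_{[0,2π]^ι} exp(β₀ + Σ_{j∈s} β_j e^{i m_j·θ}) dθ = e^{β₀} · R` with a REAL `R ≥ (2π)^{|ι|} > 0`.
In particular the integral is non-zero, and it is a positive real whenever `β₀` is real. [folklore] -/
theorem integral_cexp_const_add_sum {J : Type*} (s : Finset J) (β₀ : ℂ) (β : J → ℝ)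
    (hβ : ∀ j ∈ s, 0 ≤ β j) (m : J → ι → ℤ) :
    ∃ R : ℝ, (2 * Real.pi) ^ Fintype.card ι ≤ R ∧
      ∫ θ, Complex.exp (β₀ + ∑ j ∈ s,
          (β j : ℂ) * Complex.exp (Complex.I * ((∑ x, (m j x : ℝ) * θ x : ℝ) : ℂ)))
        ∂(volume.restrict (Set.pi Set.univ (fun _ : ι => Set.Icc (0:ℝ) (2 * Real.pi)))) =
        Complex.exp β₀ * (R : ℂ) := by
  obtain ⟨R, -, hR0, hint⟩ := integral_cexp_phase_mul_cexp_sum s β hβ m 0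
  refine ⟨R, hR0 rfl, ?_⟩
  rw [← hint, ← integral_const_mul]
  refine integral_congr_ae (ae_of_all _ fun θ => ?_)
  simp only [Pi.zero_apply, Int.cast_zero, zero_mul, Finset.sum_const_zero, Complex.ofReal_zero,
    mul_zero, Complex.exp_zero, one_mul, Complex.exp_add]

/-- Corollary: such an integral never vanishes. [folklore] -/
theorem integral_cexp_const_add_sum_ne_zero {J : Type*} (s : Finset J) (β₀ : ℂ) (β : J → ℝ)
    (hβ : ∀ j ∈ s, 0 ≤ β j) (m : J → ι → ℤ) :
    ∫ θ, Complex.exp (β₀ + ∑ j ∈ s,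
          (β j : ℂ) * Complex.exp (Complex.I * ((∑ x, (m j x : ℝ) * θ x : ℝ) : ℂ)))
        ∂(volume.restrict (Set.pi Set.univ (fun _ : ι => Set.Icc (0:ℝ) (2 * Real.pi)))) ≠ 0 := by
  obtain ⟨R, hR, hint⟩ := integral_cexp_const_add_sum s β₀ β hβ m
  rw [hint]
  have hRpos : 0 < R := lt_of_lt_of_le (by positivity) hR
  exact mul_ne_zero (Complex.exp_ne_zero _) (by exact_mod_cast hRpos.ne')

/-- Corollary: with a REAL constant term the integral is a positive real
(`0 < Re`, `Im = 0`). [folklore] -/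
theorem integral_cexp_const_add_sum_pos {J : Type*} (s : Finset J) (β₀ : ℝ) (β : J → ℝ)
    (hβ : ∀ j ∈ s, 0 ≤ β j) (m : J → ι → ℤ) :
    0 < (∫ θ, Complex.exp ((β₀ : ℂ) + ∑ j ∈ s,
          (β j : ℂ) * Complex.exp (Complex.I * ((∑ x, (m j x : ℝ) * θ x : ℝ) : ℂ)))
        ∂(volume.restrict (Set.pi Set.univ (fun _ : ι => Set.Icc (0:ℝ) (2 * Real.pi))))).re ∧
    (∫ θ, Complex.exp ((β₀ : ℂ) + ∑ j ∈ s,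
          (β j : ℂ) * Complex.exp (Complex.I * ((∑ x, (m j x : ℝ) * θ x : ℝ) : ℂ)))
        ∂(volume.restrict (Set.pi Set.univ (fun _ : ι => Set.Icc (0:ℝ) (2 * Real.pi))))).im = 0 := by
  obtain ⟨R, hR, hint⟩ := integral_cexp_const_add_sum s (β₀ : ℂ) β hβ m
  have hRpos : 0 < R := lt_of_lt_of_le (by positivity) hR
  rw [hint, ← Complex.ofReal_exp]
  constructor
  · rw [← Complex.ofReal_mul, Complex.ofReal_re]; positivity
  · rw [← Complex.ofReal_mul, Complex.ofReal_im]

end Literature.Analysis.Fourier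

end
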